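import Summits.QuantumAdvantage.QuantumAdvantage.Theorems.LinnikCubicClassGroupsDegreeOnePrimesEscapeDivisionPNTPiCongr
import Summits.QuantumAdvantage.QuantumAdvantage.Theorems.LinnikCubicClassGroupsDegreeOnePrimesEscapeDivisionPNTQuadraticZeroFree
import Mathlib.GroupTheory.SpecificGroups.Cyclic
import HarnessLib

/-!
# The Chebotarev density theorem in the Linnik range for Galois fields of odd prime degree (cyclic cubics)

Topic `Summits/QuantumAdvantage/QuantumAdvantage/Theorems`, cell B2b-1 (linnik-cubic), PART A (gen 11);
helper toward the crux `DegreeOnePrimesEscape` (stmt-QuantumAdvantage-11543) of route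
`LinnikCubicClassGroups`.  HONEST FRAMING: the value of this file is a THEOREM (kernel-checked, GRH-free,
Siegel-free, no hypothesis) — NOT summit progress.

In a Galois number field `N` of degree `n` an unramified prime `p` with Frobenius of order `m` has splitting
type `{m, …, m}` (`n/m` entries) — `splittingType_eq_replicate_orderOf` (Dedekind; the permutation character
of the regular representation).  For `[N:ℚ] = ℓ` an ODD PRIME, `Gal(N/ℚ) ≅ ℤ/ℓ` has the two divisions `{1}`
and `G ∖ {1}`, no quadratic subfield, hence no exceptional zero (Heilbronn–Stark), and the division prime
number theorem (`division_PNT_pi_congr`, case (A)) reads: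

* `splittingType_PNT_galois_prime` — for an odd prime `ℓ` and `0 < ε ≤ 1` there is `L > 0` such that for
  every Galois number field `N` of degree `ℓ` and every `x ≥ |d_N|^L`:
  `|#{p ≤ x : p splits completely in N} − Li(x)/ℓ| ≤ ε Li(x)/ℓ` and
  `|#{p ≤ x : p inert in N} − (ℓ−1) Li(x)/ℓ| ≤ ε (ℓ−1) Li(x)/ℓ` (all primes counted);
* `splittingType_PNT_cyclicCubic` — the cyclic cubic fields: densities `1/3` and `2/3`, no exceptional term.

Together with `splittingType_PNT_cubic` / `splittingType_PNT_pureCubic` this is the Chebotarev density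
theorem in the Linnik range for EVERY cubic field. [cite: LagariasMontgomeryOdlyzko1979, Theorem 1.1]
[cite: ThornerZaman2019, Theorem 1.4]
-/

noncomputable section

open scoped NumberField nonZeroDivisors
open Finset Real Ideal NumberField
open Literature.NumberTheory.NumberFields Literature.NumberTheory.LFunctions
  Literature.NumberTheory.LFunctions.NumberField

namespace Summit.QuantumAdvantage.QuantumAdvantage.Theorems.DegreeOnePrimesEscape

/-! ### Splitting types in a Galois field -/

/-- `#{g : g φ^j g⁻¹ = 1} = |G|` if `φ^j = 1`, else `0` (any group). -/
theorem natCard_conj_pow_mem_bot {G : Type*} [Group G] (φ : G) (j : ℕ) [Decidable (φ ^ j = 1)] :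
    Nat.card {g : G // g * φ ^ j * g⁻¹ ∈ (⊥ : Subgroup G)} = if φ ^ j = 1 then Nat.card G else 0 := by
  split_ifs with h
  · exact Nat.card_congr (Equiv.subtypeUnivEquiv fun g => by rw [Subgroup.mem_bot, h, mul_one, mul_inv_cancel])
  · haveI : IsEmpty {g : G // g * φ ^ j * g⁻¹ ∈ (⊥ : Subgroup G)} :=
      ⟨fun g => h (conj_eq_one_iff.mp (Subgroup.mem_bot.mp g.2))⟩
    exact Nat.card_of_isEmpty

section Galois

variable {N : Type} [Field N] [NumberField N] [IsGalois ℚ N]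

/-- **Splitting types in a Galois field**: if `φ` is a Frobenius at `Q ∣ p` with trivial inertia, of order
`m`, then `splittingType N p = {m, …, m}` (`[N:ℚ]/m` entries). [cite: Perlis1977, §1] -/
theorem splittingType_eq_replicate_orderOf {p : ℕ} (hp : p.Prime) (Q : Ideal (𝓞 N)) [Q.IsMaximal]
    [Q.LiesOver (span {(p : ℤ)})] {φ : N ≃ₐ[ℚ] N} (hφ : IsArithFrobAt ℤ φ Q)
    (hI : Q.inertia (N ≃ₐ[ℚ] N) = ⊥) :
    splittingType N p = Multiset.replicate (Module.finrank ℚ N / orderOf φ) (orderOf φ) := by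
  classical
  set n := Module.finrank ℚ N with hn
  set m := orderOf φ with hm
  have hm0 : 0 < m := orderOf_pos φ
  have hmn : m ∣ n := by rw [hn, ← IsGalois.card_aut_eq_finrank]; exact orderOf_dvd_natCard φ
  have hsums : ∀ j : ℕ, ((splittingType (⊤ : IntermediateField ℚ N) p).filter (· ∣ j)).sum =
      ((Multiset.replicate (n / m) m).filter (· ∣ j)).sum := by
    intro j
    have hk := card_fixingSubgroup_mul_sum_filter_dvd (⊤ : IntermediateField ℚ N) hp Q hφ hI j
    rw [IntermediateField.fixingSubgroup_top, Subgroup.card_bot, one_mul, natCard_conj_pow_mem_bot,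
      IsGalois.card_aut_eq_finrank] at hk
    rw [hk]
    by_cases hj : m ∣ j
    · rw [if_pos (orderOf_dvd_iff_pow_eq_one.mp hj), Multiset.filter_eq_self.mpr (fun a ha => by
        rwa [Multiset.eq_of_mem_replicate ha]), Multiset.sum_replicate, smul_eq_mul, Nat.div_mul_cancel hmn]
    · rw [if_neg (fun h => hj (orderOf_dvd_iff_pow_eq_one.mpr h)), Multiset.filter_eq_nil.mpr (fun a ha => by
        rwa [Multiset.eq_of_mem_replicate ha]), Multiset.sum_zero]
  have htop := eq_of_forall_sum_filter_dvd_eq _ _ _ rfl (fun f hf => splittingType_pos hp hf)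
    (fun f hf => by rw [Multiset.eq_of_mem_replicate hf]; exact hm0) hsums
  rw [ArithmeticallyEquivalent.of_algEquiv (IntermediateField.topEquiv (F := ℚ) (E := N)).symm p hp]
  exact htop

/-- A Galois field of odd degree has no exceptional zero in the Heilbronn–Stark window (no quadratic
subfield). [cite: Stark1974, Theorem 3] -/
theorem not_exists_exceptional_of_odd (hN : 1 < Module.finrank ℚ N) (hodd : Odd (Module.finrank ℚ N))
    {c : ℝ} (hc4 : c ≤ 1 / 4) :
    ¬ ∃ β₁ : ℝ, dedekindZeta₁ N β₁ = 0 ∧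
      1 - c / (Real.log ((NumberField.discr N).natAbs : ℝ) + Real.log 4) < β₁ ∧ β₁ < 1 := by
  rintro ⟨β₁, hζ₁, hβ₁c, hβ₁1⟩
  obtain ⟨k, hk2, -⟩ := exists_quadratic_subfield_zero_of_exceptional hN hc4 hζ₁ hβ₁c hβ₁1
  have hmul := Module.finrank_mul_finrank ℚ k N
  rw [hk2] at hmul
  exact (Nat.not_even_iff_odd.mpr hodd) ⟨Module.finrank k N, by omega⟩

end Galois

/-! ### The theorem -/

set_option maxHeartbeats 4000000 in
/-- **The Chebotarev density theorem in the Linnik range for Galois fields of odd prime degree** (see the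
module docstring): densities `1/ℓ` (split) and `(ℓ−1)/ℓ` (inert), relative error `ε`, all `x ≥ |d_N|^L`, no
exceptional term.  Unconditional. [cite: LagariasMontgomeryOdlyzko1979, Theorem 1.1]
[cite: ThornerZaman2019, Theorem 1.4] -/
theorem splittingType_PNT_galois_prime (ℓ : ℕ) (hℓ : ℓ.Prime) (hℓ2 : ℓ ≠ 2) {ε : ℝ} (hε : 0 < ε) (hε1 : ε ≤ 1) :
    ∃ L : ℝ, 0 < L ∧ ∀ (N : Type) [Field N] [NumberField N] [IsGalois ℚ N], Module.finrank ℚ N = ℓ →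
      ∀ x : ℝ, ((NumberField.discr N).natAbs : ℝ) ^ L ≤ x →
        |((((Nat.primesLE ⌊x⌋₊).filter (fun p : ℕ => splittingType N p = Multiset.replicate ℓ 1)).card : ℕ) : ℝ) -
            offsetLogIntegral x / ℓ| ≤ ε * (offsetLogIntegral x / ℓ) ∧
        |((((Nat.primesLE ⌊x⌋₊).filter (fun p : ℕ => splittingType N p = {ℓ})).card : ℕ) : ℝ) -
            (ℓ - 1) * offsetLogIntegral x / ℓ| ≤ ε * ((ℓ - 1) * offsetLogIntegral x / ℓ) := by
  classical
  haveI := Fact.mk hℓ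
  have hℓ1 : 1 < ℓ := hℓ.one_lt
  have hℓodd : Odd ℓ := hℓ.odd_of_ne_two hℓ2
  obtain ⟨L, c, hL, hc, -, hc4, h⟩ := division_PNT_pi_congr ℓ hℓ1 hε hε1 one_pos
  refine ⟨L, hL, fun N _ _ _ hN x hx => ?_⟩
  have hN1 : 1 < Module.finrank ℚ N := by rw [hN]; exact hℓ1
  have hcard : Nat.card (N ≃ₐ[ℚ] N) = ℓ := by rw [IsGalois.card_aut_eq_finrank, hN]
  have hexc := not_exists_exceptional_of_odd hN1 (by rw [hN]; exact hℓodd) hc4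
  -- orders: `1` has order `1`, everything else order `ℓ` and generates `G`
  have hord : ∀ τ : N ≃ₐ[ℚ] N, τ ≠ 1 → orderOf τ = ℓ := by
    intro τ hτ
    have hdvd : orderOf τ ∣ ℓ := hcard ▸ orderOf_dvd_natCard τ
    rcases (Nat.dvd_prime hℓ).mp hdvd with h1 | h2
    · exact absurd (orderOf_eq_one_iff.mp h1) hτ
    · exact h2
  -- the dictionary at an unramified prime, via any Frobenius
  have hdict : ∀ (σ : N ≃ₐ[ℚ] N) (p : ℕ), p.Prime → ¬ ((p : ℤ) ∣ NumberField.discr N) →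
      ((splittingType N p = Multiset.replicate (ℓ / orderOf σ) (orderOf σ)) ↔
        ∃ (Q : Ideal (𝓞 N)) (_ : Q.IsMaximal) (_ : Q.LiesOver (span {(p : ℤ)})) (φ g : N ≃ₐ[ℚ] N),
          IsArithFrobAt ℤ φ Q ∧ Q.inertia (N ≃ₐ[ℚ] N) = ⊥ ∧
            Subgroup.zpowers (g * φ * g⁻¹) = Subgroup.zpowers σ) := by
    intro σ p hp hpN
    -- in a group of prime order, `⟨gφg⁻¹⟩ = ⟨σ⟩` iff `orderOf φ = orderOf σ`
    have hzp : ∀ φ g : N ≃ₐ[ℚ] N, Subgroup.zpowers (g * φ * g⁻¹) = Subgroup.zpowers σ ↔ orderOf φ = orderOf σ := by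
      intro φ g
      constructor
      · intro hz
        have h1 : Nat.card (Subgroup.zpowers (g * φ * g⁻¹)) = Nat.card (Subgroup.zpowers σ) := by rw [hz]
        rw [Nat.card_zpowers, Nat.card_zpowers] at h1
        have h2 : orderOf (g * φ * g⁻¹) = orderOf φ := by
          have := orderOf_injective (MulAut.conj g).toMonoidHom (MulAut.conj g).injective φ
          simpa using this
        rw [← h2]
        exact h1
      · intro ho
        by_cases hσ : σ = 1
        · subst hσ
          rw [orderOf_one, orderOf_eq_one_iff] at ho
          rw [ho, mul_one, mul_inv_cancel]
        · have hφ1 : φ ≠ 1 := by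
            intro h1; rw [h1, orderOf_one] at ho; exact hσ (orderOf_eq_one_iff.mp ho.symm)
          have hc1 : g * φ * g⁻¹ ≠ 1 := fun h1 => hφ1 (conj_eq_one_iff.mp h1)
          rw [zpowers_eq_top_of_prime_card hcard hc1, zpowers_eq_top_of_prime_card hcard hσ]
    constructor
    · intro hT
      obtain ⟨Q, hQmax, hQover, ⟨φ, hφ⟩, hI⟩ := exists_isArithFrobAt_of_not_dvd_discr (N := N) hp hpN
      have hφT := splittingType_eq_replicate_orderOf hp Q hφ hI
      rw [hN, hT] at hφT
      have hmem : orderOf σ ∈ Multiset.replicate (ℓ / orderOf φ) (orderOf φ) := by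
        rw [← hφT]
        exact Multiset.mem_replicate.mpr ⟨(Nat.div_pos (Nat.le_of_dvd hℓ.pos (hcard ▸ orderOf_dvd_natCard σ))
          (orderOf_pos σ)).ne', rfl⟩
      exact ⟨Q, hQmax, hQover, φ, 1, hφ, hI, (hzp φ 1).mpr (Multiset.eq_of_mem_replicate hmem).symm⟩
    · rintro ⟨Q, hQmax, hQover, φ, g, hφ, hI, hg⟩
      rw [splittingType_eq_replicate_orderOf hp Q hφ hI, hN, (hzp φ g).mp hg]
  -- densities: `|Div 1| = 1`, `|Div σ| = ℓ − 1` for `σ ≠ 1`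
  have hdiv1 : Nat.card {τ : N ≃ₐ[ℚ] N // ∃ g : N ≃ₐ[ℚ] N,
      Subgroup.zpowers (g * τ * g⁻¹) = Subgroup.zpowers (1 : N ≃ₐ[ℚ] N)} = 1 := by
    rw [Nat.card_eq_one_iff_unique]
    refine ⟨⟨?_⟩, ⟨⟨1, 1, by simp⟩⟩⟩
    rintro ⟨a, g, hg⟩ ⟨b, g', hg'⟩
    rw [Subgroup.zpowers_one_eq_bot, Subgroup.zpowers_eq_bot, conj_eq_one_iff] at hg hg'
    subst hg hg'
    rfl
  refine ⟨?_, ?_⟩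
  · -- split primes: `σ = 1`
    have hP := hdict 1
    simp only [orderOf_one, Nat.div_one] at hP
    have hmain := (h N hN 1 (fun p : ℕ => splittingType N p = Multiset.replicate ℓ 1) hP).1 hexc x hx
    rw [hdiv1, hcard] at hmain
    have e1 : (((1 : ℕ) : ℝ)) / (ℓ : ℝ) * offsetLogIntegral x = offsetLogIntegral x / ℓ := by push_cast; ring
    rwa [e1] at hmain
  · -- inert primes: `σ` a generator
    obtain ⟨σ, hσ⟩ : ∃ σ : N ≃ₐ[ℚ] N, σ ≠ 1 := by
      by_contra hall
      push Not at hall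
      have : Nat.card (N ≃ₐ[ℚ] N) = 1 := Nat.card_eq_one_iff_unique.mpr ⟨⟨fun a b => by rw [hall a, hall b]⟩, ⟨1⟩⟩
      omega
    have hP := hdict σ
    rw [hord σ hσ, Nat.div_self hℓ.pos] at hP
    have hrep : Multiset.replicate 1 ℓ = {ℓ} := rfl
    rw [hrep] at hP
    have hdivσ : Nat.card {τ : N ≃ₐ[ℚ] N // ∃ g : N ≃ₐ[ℚ] N,
        Subgroup.zpowers (g * τ * g⁻¹) = Subgroup.zpowers σ} = ℓ - 1 := by
      have e : {τ : N ≃ₐ[ℚ] N // ∃ g : N ≃ₐ[ℚ] N, Subgroup.zpowers (g * τ * g⁻¹) = Subgroup.zpowers σ} ≃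
          {τ : N ≃ₐ[ℚ] N // τ ≠ 1} :=
        Equiv.subtypeEquivRight fun τ => by
          constructor
          · rintro ⟨g, hg⟩ h1
            rw [h1, mul_one, mul_inv_cancel, Subgroup.zpowers_one_eq_bot, eq_comm, Subgroup.zpowers_eq_bot] at hg
            exact hσ hg
          · intro hτ
            refine ⟨1, ?_⟩
            rw [one_mul, inv_one, mul_one, zpowers_eq_top_of_prime_card hcard hτ,
              zpowers_eq_top_of_prime_card hcard hσ]
      rw [Nat.card_congr e, Nat.card_eq_fintype_card, Fintype.card_subtype_compl, Fintype.card_subtype_eq,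
        ← Nat.card_eq_fintype_card, hcard]
    have hmain := (h N hN σ (fun p : ℕ => splittingType N p = {ℓ}) hP).1 hexc x hx
    rw [hdivσ, hcard] at hmain
    have e1 : (((ℓ - 1 : ℕ) : ℝ)) / (ℓ : ℝ) * offsetLogIntegral x = (ℓ - 1) * offsetLogIntegral x / ℓ := by
      rw [Nat.cast_sub hℓ1.le]; push_cast; ring
    rwa [e1] at hmain

/-- **The Chebotarev density theorem for the cyclic cubic fields in the Linnik range**: for `0 < ε ≤ 1` there
is `L > 0` such that for every Galois (cyclic) cubic field `K` and every `x ≥ |d_K|^L`: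
`|#{p ≤ x : p splits completely} − Li(x)/3| ≤ ε Li(x)/3` and `|#{p ≤ x : p inert} − 2Li(x)/3| ≤ ε · 2Li(x)/3`;
no exceptional term.  Unconditional. [cite: LagariasMontgomeryOdlyzko1979, Theorem 1.1] -/
theorem splittingType_PNT_cyclicCubic {ε : ℝ} (hε : 0 < ε) (hε1 : ε ≤ 1) :
    ∃ L : ℝ, 0 < L ∧ ∀ (K : Type) [Field K] [NumberField K] [IsGalois ℚ K], Module.finrank ℚ K = 3 →
      ∀ x : ℝ, ((NumberField.discr K).natAbs : ℝ) ^ L ≤ x →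
        |((((Nat.primesLE ⌊x⌋₊).filter (fun p : ℕ => splittingType K p = {1, 1, 1})).card : ℕ) : ℝ) -
            offsetLogIntegral x / 3| ≤ ε * (offsetLogIntegral x / 3) ∧
        |((((Nat.primesLE ⌊x⌋₊).filter (fun p : ℕ => splittingType K p = {3})).card : ℕ) : ℝ) -
            2 * offsetLogIntegral x / 3| ≤ ε * (2 * offsetLogIntegral x / 3) := by
  obtain ⟨L, hL, h⟩ := splittingType_PNT_galois_prime 3 Nat.prime_three (by norm_num) hε hε1
  refine ⟨L, hL, fun K _ _ _ h3 x hx => ?_⟩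
  have := h K h3 x hx
  have hrep : Multiset.replicate 3 1 = ({1, 1, 1} : Multiset ℕ) := rfl
  have e1 : ((3 : ℕ) : ℝ) = 3 := by norm_num
  have e2 : (3 : ℝ) - 1 = 2 := by norm_num
  rw [hrep, e1, e2] at this
  exact this

end Summit.QuantumAdvantage.QuantumAdvantage.Theorems.DegreeOnePrimesEscape

end
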